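import Summits.CriticalPhenomena.CardyFormulaZ2.Theorems.CardyBoundaryCoulombGasHalfPlaneMarkDensityLawSubsequentialLimits

/-!
# Line `Sketch`, open stub C⁺ — a priori structure of the collinear half-plane crossing function, IV:
# C⁺ (hence the crux) is the identification of the joint subsequential limits
# (crux stmt-CriticalPhenomena-5661, lead c2-0)

`P_n(a,b,c,y) := P_{1/2}[[⌊an⌋,⌊bn⌋]×{0} ↔ [⌊cn⌋,⌊yn⌋]×{0} in ℤ×ℕ]`, chamber `a < b < c < y`.

IDENTIFICATION IS THE WHOLE CONTENT: C⁺ `⟺` every joint subsequential limit of `P_n` equals `F ∘ η`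
on the chamber (`collinearCardy_iff_jointLimits`: `⟹` subsequences of a convergent sequence, `⟸` the
precompactness theorem `exists_jointSubseqLimit` of `…SubsequentialLimits` + the subsequence
principle), hence — the crux being equivalent to C⁺ (`stub_equivalence`) — `HalfPlaneMarkDensityLaw ⟺`
the same identification statement (`halfPlaneMarkDensityLaw_iff_jointLimits`).  The joint limits are
`[0,1]`-valued, monotone, continuous, translation invariant and vanish at `η = 0`
(`…SubsequentialLimits` §6); scale invariance is NOT available for a subsequential limit; Möbius
covariance and the value `F` are exactly what a proof of the crux must supply.  Registered extra stub of
the line: `stub_identification` (`stub_precompactness` is in `…SubsequentialLimits`).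
-/

noncomputable section

namespace Summit.CriticalPhenomena.CardyFormulaZ2.Cruxes.HalfPlaneMarkDensityLaw.SketchLine

open Literature.Probability.Percolation Literature.Probability.LatticeModels
open MeasureTheory Filter Set
open scoped Topology
open Summit.CriticalPhenomena.CardyFormulaZ2.Theses.CardyBoundaryCoulombGas (HalfPlaneMarkDensityLaw)
open Summit.CriticalPhenomena.CardyFormulaZ2.Theorems.HalfPlaneMarkDensityLaw.Negative

namespace Subseq

/-- Cardy's function `F` (the `RandomPlanarGeometry` copy). -/
local notation "𝔽" => Literature.Probability.RandomPlanarGeometry.cardyFunction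

/-- The cross-ratio of four collinear marks. -/
local notation "ηx" => Literature.Probability.RandomPlanarGeometry.crossRatio

/-! ## §7 C⁺ — hence the crux — is the identification of the joint subsequential limits -/

/-- **C⁺ ⟺ identification.** The collinear half-plane Cardy law for bond-`ℤ²` holds if and only if
every joint subsequential limit of `P_n` (along every strictly increasing subsequence, at every point
of the chamber simultaneously) equals `F ∘ η`.  (`⟹`: subsequences of a convergent sequence;
`⟸`: precompactness `exists_jointSubseqLimit` + the subsequence principle.) [folklore] -/
theorem collinearCardy_iff_jointLimits :
    (∀ a b c y : ℝ, a < b → b < c → c < y →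
      Tendsto (fun n : ℕ ↦ μ.real (openCrossing halfPlane (arcA a b n) (rowIcc ⌊c * n⌋ ⌊y * n⌋))) atTop
        (𝓝 (𝔽 (ηx ![a, b, c, y])))) ↔
    ∀ θ : ℕ → ℕ, StrictMono θ → ∀ G : ℝ → ℝ → ℝ → ℝ → ℝ,
      (∀ a b c y : ℝ, a < b → b < c → c < y →
        Tendsto (fun n ↦ μ.real (openCrossing halfPlane (arcA a b (θ n))
          (rowIcc ⌊c * (θ n : ℕ)⌋ ⌊y * (θ n : ℕ)⌋))) atTop (𝓝 (G a b c y))) →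
      ∀ a b c y : ℝ, a < b → b < c → c < y → G a b c y = 𝔽 (ηx ![a, b, c, y]) := by
  constructor
  · intro hC θ hθ G hG a b c y hab hbc hcy
    exact tendsto_nhds_unique (hG a b c y hab hbc hcy) ((hC a b c y hab hbc hcy).comp hθ.tendsto_atTop)
  · intro hId a b c y hab hbc hcy
    refine tendsto_of_subseq_tendsto fun ns hns ↦ ?_
    obtain ⟨φ₁, hφ₁, hmono⟩ := strictMono_subseq_of_tendsto_atTop hns
    obtain ⟨ψ, hψ, G, hG⟩ := exists_jointSubseqLimit (ns ∘ φ₁) hmono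
    refine ⟨φ₁ ∘ ψ, ?_⟩
    have h := hG a b c y hab hbc hcy
    rw [hId ((ns ∘ φ₁) ∘ ψ) (hmono.comp hψ) G hG a b c y hab hbc hcy] at h
    exact h

/-- **The crux ⟺ identification.** `HalfPlaneMarkDensityLaw` (by name) holds if and only if every
joint subsequential limit of the collinear half-plane crossing function of bond-`ℤ²` equals `F ∘ η`
on the chamber (`stub_equivalence` + `collinearCardy_iff_jointLimits`): precompactness, continuity,
monotonicity and translation invariance of the limits are theorems (§5–§6); their Möbius covariance
and the value `F` are the open content. [folklore] -/
theorem halfPlaneMarkDensityLaw_iff_jointLimits :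
    HalfPlaneMarkDensityLaw ↔
    ∀ θ : ℕ → ℕ, StrictMono θ → ∀ G : ℝ → ℝ → ℝ → ℝ → ℝ,
      (∀ a b c y : ℝ, a < b → b < c → c < y →
        Tendsto (fun n ↦ μ.real (openCrossing halfPlane (arcA a b (θ n))
          (rowIcc ⌊c * (θ n : ℕ)⌋ ⌊y * (θ n : ℕ)⌋))) atTop (𝓝 (G a b c y))) →
      ∀ a b c y : ℝ, a < b → b < c → c < y → G a b c y = 𝔽 (ηx ![a, b, c, y]) :=
  stub_equivalence.trans collinearCardy_iff_jointLimits

/-! ## §8 What existence alone would give: scale invariance of a full limit -/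

/-- Along the multiples `q·k`, the dilated configuration `t·z` with `t = p/q` is the undilated one at
scale `p·k`: `⌊(t x)(q k)⌋ = ⌊x (p k)⌋`. [folklore] -/
theorem floor_dilate {p q : ℕ} (hq : 0 < q) (x : ℝ) (k : ℕ) :
    ⌊(p : ℝ) / q * x * ((q * k : ℕ) : ℝ)⌋ = ⌊x * ((p * k : ℕ) : ℝ)⌋ := by
  have hq' : (q : ℝ) ≠ 0 := by exact_mod_cast hq.ne'
  congr 1; push_cast; field_simp

/-- **Scale invariance of a full limit.** If `P_n` converges at every point of the chamber (the
existence half of C⁺), its limit `G` is invariant under every dilation `t > 0`: rational `t = p/q`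
by comparing the scales `qk` and `pk` (`floor_dilate`), real `t` by the continuity of `G`
(`continuousOn_of_jointLimit` with `θ = id`) and density of `ℚ`.  So existence alone leaves a
continuous translation- and dilation-invariant function of the marks; Cardy's claim is that it
factors through the cross-ratio with profile `F`. [folklore] -/
theorem dilate_of_limit {G : ℝ → ℝ → ℝ → ℝ → ℝ}
    (hG : ∀ a b c y : ℝ, a < b → b < c → c < y →
      Tendsto (fun n : ℕ ↦ μ.real (openCrossing halfPlane (arcA a b n) (rowIcc ⌊c * n⌋ ⌊y * n⌋)))
        atTop (𝓝 (G a b c y)))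
    {a b c y : ℝ} (hab : a < b) (hbc : b < c) (hcy : c < y) {t : ℝ} (ht : 0 < t) :
    G (t * a) (t * b) (t * c) (t * y) = G a b c y := by
  -- joint limit along θ = id
  have hG' : ∀ a b c y : ℝ, a < b → b < c → c < y →
      Tendsto (fun n : ℕ ↦ μ.real (openCrossing halfPlane (arcA a b (id n))
        (rowIcc ⌊c * (id n : ℕ)⌋ ⌊y * (id n : ℕ)⌋))) atTop (𝓝 (G a b c y)) := hG
  -- rational dilations
  have hrat : ∀ p q : ℕ, 0 < p → 0 < q →
      G ((p : ℝ) / q * a) ((p : ℝ) / q * b) ((p : ℝ) / q * c) ((p : ℝ) / q * y) = G a b c y := by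
    intro p q hp hq
    have hpq : (0 : ℝ) < (p : ℝ) / q := by positivity
    have h1 := (hG ((p : ℝ) / q * a) ((p : ℝ) / q * b) ((p : ℝ) / q * c) ((p : ℝ) / q * y)
      (by nlinarith) (by nlinarith) (by nlinarith)).comp
      ((strictMono_mul_left_of_pos hq).tendsto_atTop)
    have h2 := (hG a b c y hab hbc hcy).comp ((strictMono_mul_left_of_pos hp).tendsto_atTop)
    refine tendsto_nhds_unique h1 (h2.congr fun k ↦ ?_)
    simp only [Function.comp_apply, arcA_eq_rowIcc, floor_dilate hq]
  -- continuity in the dilation parameter at t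
  have hcont : ContinuousAt (fun s : ℝ ↦ G (s * a) (s * b) (s * c) (s * y)) t := by
    have hc := continuousOn_of_jointLimit hG' strictMono_id
    have hmem : ∀ s : ℝ, 0 < s → (s * a, s * b, s * c, s * y) ∈
        {p : ℝ × ℝ × ℝ × ℝ | p.1 < p.2.1 ∧ p.2.1 < p.2.2.1 ∧ p.2.2.1 < p.2.2.2} :=
      fun s hs ↦ ⟨by simp only; nlinarith, by simp only; nlinarith, by simp only; nlinarith⟩
    have hin : ContinuousAt (fun s : ℝ ↦ ((s * a, s * b, s * c, s * y) : ℝ × ℝ × ℝ × ℝ)) t := by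
      fun_prop
    have hcw := (hc _ (hmem t ht)).continuousAt
      ((IsOpen.mem_nhds_iff ?_).2 (hmem t ht))
    · exact ContinuousAt.comp (f := fun s : ℝ ↦ ((s * a, s * b, s * c, s * y) : ℝ × ℝ × ℝ × ℝ))
        hcw hin
    · exact (isOpen_lt continuous_fst (continuous_fst.comp continuous_snd)).inter
        ((isOpen_lt (continuous_fst.comp continuous_snd)
          (continuous_fst.comp (continuous_snd.comp continuous_snd))).inter
        (isOpen_lt (continuous_fst.comp (continuous_snd.comp continuous_snd))
          (continuous_snd.comp (continuous_snd.comp continuous_snd))))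
  -- a sequence of positive rationals p_k/q_k → t
  have hseq : ∀ k : ℕ, ∃ r : ℚ, t < r ∧ (r : ℝ) < t + 1 / ((k : ℝ) + 1) :=
    fun k ↦ exists_rat_btwn (lt_add_of_pos_right t (by positivity))
  choose r hr1 hr2 using hseq
  have hrt : Tendsto (fun k ↦ (r k : ℝ)) atTop (𝓝 t) := by
    refine tendsto_of_tendsto_of_tendsto_of_le_of_le' tendsto_const_nhds
      (by simpa using tendsto_const_nhds.add (tendsto_one_div_add_atTop_nhds_zero_nat (𝕜 := ℝ)))
      (Eventually.of_forall fun k ↦ (hr1 k).le) (Eventually.of_forall fun k ↦ (hr2 k).le)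
  have hlim := hcont.tendsto.comp hrt
  -- along the sequence the value is constant
  have hconst : ∀ k, G ((r k : ℝ) * a) ((r k : ℝ) * b) ((r k : ℝ) * c) ((r k : ℝ) * y) = G a b c y := by
    intro k
    have hrk : (0 : ℝ) < r k := ht.trans (hr1 k)
    have hrk' : (0 : ℚ) < r k := by exact_mod_cast hrk
    have hnum : 0 < (r k).num := Rat.num_pos.2 hrk'
    have e : ((r k : ℚ) : ℝ) = (((r k).num.toNat : ℕ) : ℝ) / ((r k).den : ℕ) := by
      have h1 : (((r k).num.toNat : ℕ) : ℤ) = (r k).num := Int.toNat_of_nonneg hnum.le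
      rw [Rat.cast_def]
      congr 1
      exact_mod_cast h1.symm
    rw [e]
    exact hrat _ _ (by omega) (r k).den_pos
  have hlim' : Tendsto (fun k ↦ G ((r k : ℝ) * a) ((r k : ℝ) * b) ((r k : ℝ) * c) ((r k : ℝ) * y))
      atTop (𝓝 (G a b c y)) := by
    simp only [hconst]; exact tendsto_const_nhds
  exact tendsto_nhds_unique hlim hlim'

end Subseq

/-- **Registered extra stub of line `Sketch` (lead c2-0): the crux is the IDENTIFICATION of the joint
subsequential limits.**  `HalfPlaneMarkDensityLaw` (by name) holds iff every joint subsequential limit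
`G` of `P_n` along every strictly increasing subsequence equals `F ∘ η` on the chamber. [folklore] -/
theorem stub_identification :
    HalfPlaneMarkDensityLaw ↔
    ∀ θ : ℕ → ℕ, StrictMono θ → ∀ G : ℝ → ℝ → ℝ → ℝ → ℝ,
      (∀ a b c y : ℝ, a < b → b < c → c < y →
        Tendsto (fun n ↦ μ.real (openCrossing halfPlane (arcA a b (θ n))
          (rowIcc ⌊c * (θ n : ℕ)⌋ ⌊y * (θ n : ℕ)⌋))) atTop (𝓝 (G a b c y))) →
      ∀ a b c y : ℝ, a < b → b < c → c < y →
        G a b c y = Literature.Probability.RandomPlanarGeometry.cardyFunction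
          (Literature.Probability.RandomPlanarGeometry.crossRatio ![a, b, c, y]) :=
  Subseq.halfPlaneMarkDensityLaw_iff_jointLimits

end Summit.CriticalPhenomena.CardyFormulaZ2.Cruxes.HalfPlaneMarkDensityLaw.SketchLine

end
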